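import Mathlib
import Literature.MathematicalPhysics.QuantumLattice.WilsonDiracAP
import Summits.QuantumFields.QCD.Theorems.WilsonQuarkChessboardFlatCellOptimalStubFreeDetFormulaAllN

/-!
# The free Bloch blocks, `N` colours: determinant and coercivity of the free Wilson–Dirac operator with
direction-dependent constant phases on the `2⁴`-torus
(helper for crux stmt-QuantumFields-9307 `FlatCellOptimal`, line `registered`, stubs
`stub_hessianMarginAllN` / `stub_localNormGain_of`, sub-goal `stub_freeBlochBlocksAllN` — the
`Fin 3 ↦ Fin N` port of the sibling crux stmt-QuantumFields-9734's
`…CriticalLineDiamagnetismStubFreeBlochBlocks`, gaps G2a/G4, wave 4)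

What.  For the FREE `r = 1` Wilson–Dirac operator `B = wilsonDirac ρ_N (fun e => w e.2) m 1` on the
`2⁴`-torus `(ℤ/2)⁴` (colour `Fin N`, ANY `N : ℕ`, spin `Fin 4`, bare mass `m`) whose link variable in
direction `μ` is the CONSTANT central phase `w μ = e^{iθ_μ}·1 ∈ U(N)` — the twisted free Bloch block
`B⁰_k` of the one-loop analysis (`θ_μ = π k_μ/M + π/(2M)`):
(i) `‖det B‖² = ∏_s h(s)^{4N}` and (ii) `(∀ s, c ≤ h(s)) → c Σ_i ‖v_i‖² ≤ Σ_i ‖(B v)_i‖²`, where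
`h(s) = (m + Σ_μ (1 − cos φ_μ))² + Σ_μ sin² φ_μ`, `φ_μ = π·val(s_μ) + θ_μ`, `s ∈ (ℤ/2)⁴`
(`stub_freeBlochBlocksAllN`; the sibling's `stub_freeBlochBlocks` is the case `N = 3`, exponent `12`).
The statement is the sibling's with `Fin 3 ↦ Fin N`, `12 ↦ 4 * N`, and with the `let`s `B`, `h` turned
into universally quantified variables with defining equations, so that the registered signature
contains no `:=`; the coercivity constant is `N`-free.

How.  This is the `L = 2` case of the already ported colour-generic torus-Fourier diagonalisation
`stub_freeTwistedFourierAllN` (`…FlatCellOptimalStubFreeTwistedFourierAllN`: `B P = Q` for the unitary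
plane-wave matrix `P = F ⊗ 1_{N×4}` with colour–spin symbol `M(k) = (m + Σ_μ (1 − cos φ_μ))·1 + iΣ_μ sin φ_μ γ_μ`
at `φ_μ = 2π k_μ.val/L + θ_μ`, Clifford identity `M(k)ᴴ M(k) = h(k)·1`, `‖det B‖² = ∏ h^{4N}`,
`c ≤ h ⇒ c Σ‖v‖² ≤ Σ‖Bv‖²`), read at the angles `2π v/2 + θ = π v + θ`.  The plane-wave lemmas the
sibling file proved at `Fin 3` (`wilsonDirac_dirTwist_mulVec_apply`, `wilsonDirac_dirTwist_mulVec_planeWave`,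
`wilsonDirac_dirTwist_mul_planeP`, `coercive_of_planeWave`, `sum_norm_sq_mulVec_of_gram_diagonal`) are
re-EXPORTED from the colour-generic files into the namespace `…FreeBlocks.FreeBlochBlocks` (aliases, no
restatement), so that downstream ports see the sibling's names `FreeBlochBlocks.*` after
`open …FlatCellOptimal.FreeBlocks`.

References: Montvay–Münster, *Quantum Fields on a Lattice* §4.2 (free Wilson fermions in momentum
space; twisted boundary conditions as constant `U(1)` phases); folklore linear algebra.
Pure theorem file (no `def`s).
-/

noncomputable section

open scoped BigOperators Classical Matrix ComplexConjugate
open Finset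
open Literature.MathematicalPhysics.QuantumLattice Literature.MathematicalPhysics.QuantumFieldTheory
  Literature.Probability.LatticeModels

namespace Summit.QuantumFields.QCD.Cruxes.FlatCellOptimal.FreeBlocks

open scoped Kronecker
open Complex (I)
open Summit.QuantumFields.QCD.Cruxes.FlatCellOptimal.FreeTwistedFourier

namespace FreeBlochBlocks

/-! ### The colour-generic plane-wave lemmas, re-exported under the sibling's names (aliases) -/

export Summit.QuantumFields.QCD.Cruxes.CriticalLineDiamagnetism.ChessboardCellGain.FreeBlochBlocks
  (sum_norm_sq_mulVec_of_gram_diagonal)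

export Summit.QuantumFields.QCD.Cruxes.FlatCellOptimal.FreeTwistedFourier
  (wilsonDirac_dirTwist_mulVec_apply wilsonDirac_dirTwist_mulVec_planeWave
    wilsonDirac_dirTwist_mul_planeP coercive_of_planeWave)

/-- **The free Bloch blocks with the sibling's `let`s inlined** (`N` colours): for the free `r = 1`
Wilson–Dirac operator on the `2⁴`-torus with constant central phases `w μ = e^{iθ_μ}·1 ∈ U(N)`,
`‖det B‖² = ∏_s h(s)^{4N}` and `c ≤ h ⇒ c Σ‖v‖² ≤ Σ‖Bv‖²`,
`h(s) = (m + Σ_μ (1 − cos(π val s_μ + θ_μ)))² + Σ_μ sin²(π val s_μ + θ_μ)`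
(`stub_freeTwistedFourierAllN` at `L = 2`, angles `2π v/2 + θ = π v + θ`). -/
theorem freeBlochBlocks {N : ℕ} (θ : Fin 4 → ℝ) (m : ℝ) (w : Fin 4 → Matrix.unitaryGroup (Fin N) ℂ)
    (hw : ∀ μ, ((w μ : Matrix.unitaryGroup (Fin N) ℂ) : Matrix (Fin N) (Fin N) ℂ) =
      Complex.exp (θ μ * Complex.I) • (1 : Matrix (Fin N) (Fin N) ℂ)) :
    ‖(wilsonDirac (unitaryFundamentalRep (Fin N) ℂ) (fun e : Edge 4 2 => w e.2) m 1).det‖ ^ 2 =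
        ∏ s : Fin 4 → ZMod 2,
          ((m + ∑ μ : Fin 4, (1 - Real.cos (Real.pi * ((s μ).val : ℝ) + θ μ))) ^ 2 +
            ∑ μ : Fin 4, Real.sin (Real.pi * ((s μ).val : ℝ) + θ μ) ^ 2) ^ (4 * N) ∧
      ∀ c : ℝ, (∀ s : Fin 4 → ZMod 2, c ≤
          (m + ∑ μ : Fin 4, (1 - Real.cos (Real.pi * ((s μ).val : ℝ) + θ μ))) ^ 2 +
            ∑ μ : Fin 4, Real.sin (Real.pi * ((s μ).val : ℝ) + θ μ) ^ 2) →
        ∀ v : TorusSite 4 2 × Fin N × Fin 4 → ℂ,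
          c * ∑ i, ‖v i‖ ^ 2 ≤
            ∑ i, ‖((wilsonDirac (unitaryFundamentalRep (Fin N) ℂ) (fun e : Edge 4 2 => w e.2) m 1).mulVec
              v) i‖ ^ 2 := by
  -- adapted from the worked example of the `stub_freeTwistedFourierAllN` worker (lead folder scratch)
  -- the angles at `L = 2`: `2π v / 2 + t = π v + t`
  have hθ : ∀ v t : ℝ, 2 * Real.pi * v / ((2 : ℕ) : ℝ) + t = Real.pi * v + t := fun v t => by
    push_cast
    ring
  have key := stub_freeTwistedFourierAllN N 2 θ m w hw _ _ _ _ (fun _ _ => rfl) (fun _ => rfl)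
    (fun _ => rfl) rfl
  simp only [hθ] at key
  exact ⟨key.1, key.2.1⟩

end FreeBlochBlocks

open FreeBlochBlocks

/-- **The free Bloch blocks, `N` colours** (sub-goal `stub_freeBlochBlocksAllN`): for the free `r = 1`
Wilson–Dirac operator `B` on the `2⁴`-torus with the constant central direction-dependent phases
`w μ = e^{iθ_μ}·1 ∈ U(N)` on the `μ`-links and bare mass `m` (`B`, `h` given by their defining equations),
`h(s) = (m + Σ_μ (1 − cos(π val s_μ + θ_μ)))² + Σ_μ sin²(π val s_μ + θ_μ)`, `s ∈ (ℤ/2)⁴`: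
(i) `‖det B‖² = ∏_s h(s)^{4N}`; (ii) if `c ≤ h` then `c Σ_i ‖v_i‖² ≤ Σ_i ‖(B v)_i‖²`
(plane-wave diagonalisation, `B P = Q`, `Qᴴ Q = diagonal (h ∘ fst)`, `P` unitary). -/
theorem stub_freeBlochBlocksAllN : ∀ (N : ℕ) (θ : Fin 4 → ℝ) (m : ℝ) (w : Fin 4 → Matrix.unitaryGroup (Fin N) ℂ), (∀ μ, ((w μ : Matrix.unitaryGroup (Fin N) ℂ) : Matrix (Fin N) (Fin N) ℂ) = Complex.exp (θ μ * Complex.I) • (1 : Matrix (Fin N) (Fin N) ℂ)) → ∀ (B : Matrix (TorusSite 4 2 × Fin N × Fin 4) (TorusSite 4 2 × Fin N × Fin 4) ℂ) (h : (Fin 4 → ZMod 2) → ℝ), B = wilsonDirac (unitaryFundamentalRep (Fin N) ℂ) (fun e : Edge 4 2 => w e.2) m 1 → (∀ s, h s = (m + ∑ μ : Fin 4, (1 - Real.cos (Real.pi * ((s μ).val : ℝ) + θ μ))) ^ 2 + ∑ μ : Fin 4, Real.sin (Real.pi * ((s μ).val : ℝ) + θ μ) ^ 2) → ‖B.det‖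 ^ 2 = ∏ s : Fin 4 → ZMod 2, h s ^ (4 * N) ∧ ∀ (c : ℝ), (∀ s, c ≤ h s) → ∀ v : TorusSite 4 2 × Fin N × Fin 4 → ℂ, c * ∑ i, ‖v i‖ ^ 2 ≤ ∑ i, ‖(B.mulVec v) i‖ ^ 2 := by
  intro N θ m w hw B h hB hh
  have eh : h = fun s : Fin 4 → ZMod 2 =>
      (m + ∑ μ : Fin 4, (1 - Real.cos (Real.pi * ((s μ).val : ℝ) + θ μ))) ^ 2 +
        ∑ μ : Fin 4, Real.sin (Real.pi * ((s μ).val : ℝ) + θ μ) ^ 2 := funext hh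
  subst eh
  subst hB
  exact freeBlochBlocks θ m w hw

end Summit.QuantumFields.QCD.Cruxes.FlatCellOptimal.FreeBlocks

end
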